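import Summits.Schanuel.Schanuel.Theorems.ZilberEacParamFibreCurveGap
import Summits.Schanuel.Schanuel.Theorems.ZilberEacParamFibreCurveGrowthTilt
import Summits.Schanuel.Schanuel.Theorems.ZilberEacFibreCurveEdgeLemmas
import HarnessLib

/-!
# Polynomially parametrised base curves, XLIII: the TILTED-EDGE theorem below the Puiseux gap —
# fibre curves whose top `t`-row misses an extreme `y₀`-column are dense in ALL regimes

HONEST FRAMING.  Cell `pub-schanuel` (Zilber's Exponential-Algebraic Closedness, case ladder;
host summit Schanuel), seat 2, gen 21.  Surfaces `S(g; Q)`, `Q ∈ ℂ[t, y₀]` irreducible, over a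
polynomial curve `(g₀, g₁)` with `2 ≤ d = deg g₀ < n = deg g₁`.  After gens 19–21 the undecided
fibre curves have `d ∣ n`, vanishing phase and NO gap (`g₁ = c g₀^e + D`, `deg D ≤ n - d`); there the
escape of `x₁ = g₁(t)` along the zeros of `Q(t, e^{g₀(t)})` is decided at the order
`‖t‖^{n-d} log ‖t‖`, whose coefficient is proportional to the SLOPE `μ` of the Newton edge of `Q`
carrying the zero sequence (growth lemma of file XLII, engine of file XXXVIII).  A tilted upper
edge exists as soon as the top `t`-row of `supp Q` misses the monomial of largest (or smallest)
`y₀`-degree (gen 18's `exists_upper_edge_tilt_right/left`).  Hence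
(`unprojectedDense_paramSurface₃_of_y0_topRight/_topLeft`): `2 ≤ d < n`, `Q ∈ ℂ[t, y₀]` irreducible
whose top row does not reach the rightmost (leftmost) column ⟹ `S(g; Q)` has Zariski-dense
exponential points — in EVERY regime (`d ∤ n` and non-vanishing phase: gen 19; gap: file XL;
no gap: the tilted edge).  The residual fibre-curve class over `2 ≤ d < n` is thereby: `d ∣ n`,
vanishing phase, no gap, AND the top row spanning both extreme columns (`paramFibreCurve_residual`),
where — as over graphs (gen 18) — an equimodular condition on the top-row roots should decide;
OPEN.  Mantova–Masser's question is OPEN in general (PLMS 2024 §1 p. 5); NOT Schanuel's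
conjecture (neither used nor implied; EAC ⇏ SC); `EC(3,2)` stays OPEN.
-/

noncomputable section

open Filter Topology Metric Set Complex MvPolynomial
open Literature.NumberTheory.Transcendental Literature.ModelTheory.Zilber
open Literature.ModelTheory.ExponentialFields

set_option linter.dupNamespace false

namespace Summit.Schanuel.Schanuel.Theorems

/-! ## Part A. Escaping exponential points along a tilted edge -/

/-- **Zeros of `Q(t, e^{g₀(t)})` attached to a TILTED edge, with escape of `g₁ = c g₀^e + D` below
the gap.**  `deg g₀ = d ≥ 2`, `Q ∈ ℂ[t, y₀]`, an upper edge `m₀ + μ m₁ ≤ κ` of `supp Q` with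
`μ ≠ 0` through two monomials of different `y₀`-degree, `ω` a root direction, `e ≥ 2`, `c ≠ 0`,
`Re(c i^e) = 0`, `deg D ≤ d(e-1)`.  Then there are zeros `t_k` with
`|Re g₁(t_k)|/log(2 + ‖g₁(t_k)‖) → ∞`. (new) -/
theorem exists_paramSurface_expPoints_of_y0_tilt (g₀ g₁ : Polynomial ℂ)
    (hd : 2 ≤ g₀.natDegree) (Q : MvPolynomial (Fin 3) ℂ)
    (hQ2 : ∀ m ∈ Q.support, m 2 = 0) (μ κ : ℝ) (hμ : μ ≠ 0)
    (hκ : ∀ m ∈ Q.support, ((m 0 : ℕ) : ℝ) + μ * (m 1 : ℕ) ≤ κ)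
    {ma mc : Fin 3 →₀ ℕ} (hma : ma ∈ Q.support) (hmc : mc ∈ Q.support) (hjne : ma 1 ≠ mc 1)
    (hja : ((ma 0 : ℕ) : ℝ) + μ * (ma 1 : ℕ) = κ) (hjc : ((mc 0 : ℕ) : ℝ) + μ * (mc 1 : ℕ) = κ)
    {c : ℂ} (hc : c ≠ 0) {e : ℕ} (he : 2 ≤ e) {D : Polynomial ℂ}
    (hD : g₁ = Polynomial.C c * g₀ ^ e + D) (hph : (c * I ^ e).re = 0)
    (hDdeg : D.natDegree ≤ g₀.natDegree * (e - 1))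
    {ω : ℂ} {σ : ℤ} (hσ : σ = 1 ∨ σ = -1)
    (hω : g₀.leadingCoeff * ω ^ g₀.natDegree = 2 * Real.pi * I * σ) :
    ∃ t : ℕ → ℂ, (∀ k, MvPolynomial.eval ![t k, exp (g₀.eval (t k)), exp (g₁.eval (t k))] Q = 0) ∧
      Tendsto (fun k => |(g₁.eval (t k)).re| / Real.log (2 + ‖g₁.eval (t k)‖)) atTop atTop := by
  classical
  set q : (Fin 3 →₀ ℕ) → Polynomial ℂ := fun m =>
    Polynomial.C (Q.coeff m) * Polynomial.X ^ (m 0) with hq_def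
  set ex : (Fin 3 →₀ ℕ) → ℕ := fun m => m 1 with hex_def
  have hq_deg : ∀ m ∈ Q.support, (q m).natDegree = m 0 := fun m hm =>
    Polynomial.natDegree_C_mul_X_pow _ _ (MvPolynomial.mem_support_iff.1 hm)
  have hq_lc : ∀ m, (q m).leadingCoeff = Q.coeff m := fun m =>
    Polynomial.leadingCoeff_C_mul_X_pow _ _
  have hκ' : ∀ m ∈ Q.support, ((q m).natDegree : ℝ) + μ * ex m ≤ κ := fun m hm => by
    rw [hq_deg m hm]; exact hκ m hm
  set Jt := Q.support.filter (fun m => ((q m).natDegree : ℝ) + μ * ex m = κ) with hJt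
  set Qμ : Polynomial ℂ := ∑ m ∈ Jt, Polynomial.C (q m).leadingCoeff * Polynomial.X ^ (ex m)
    with hQμ
  have hmem_top : ∀ {m}, m ∈ Q.support → ((m 0 : ℝ) + μ * ex m = κ) → m ∈ Jt := fun {m} hm h =>
    Finset.mem_filter.2 ⟨hm, by rw [hq_deg m hm]; exact h⟩
  have hmaT : ma ∈ Jt := hmem_top hma hja
  have hmcT : mc ∈ Jt := hmem_top hmc hjc
  have hinj : ∀ m ∈ Jt, ∀ m' ∈ Jt, ex m = ex m' → m = m' := by
    intro m hm m' hm' hee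
    obtain ⟨hmM, hmt⟩ := Finset.mem_filter.1 hm
    obtain ⟨hm'M, hm't⟩ := Finset.mem_filter.1 hm'
    have h0eq : m 0 = m' 0 := by
      rw [hq_deg m hmM] at hmt; rw [hq_deg m' hm'M] at hm't
      rw [hee] at hmt
      have : (m 0 : ℝ) = m' 0 := by linarith
      exact_mod_cast this
    have h1eq : m 1 = m' 1 := hee
    have h2eq : m 2 = m' 2 := by rw [hQ2 m hmM, hQ2 m' hm'M]
    ext i
    fin_cases i
    · exact h0eq
    · exact h1eq
    · exact h2eq
  have hcoeff : ∀ m₁ ∈ Jt, Qμ.coeff (ex m₁) = Q.coeff m₁ := by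
    intro m₁ hm₁
    rw [hQμ, Polynomial.finsetSum_coeff, Finset.sum_eq_single m₁]
    · rw [Polynomial.coeff_C_mul, Polynomial.coeff_X_pow, if_pos rfl, mul_one, hq_lc]
    · intro m hm hne
      rw [Polynomial.coeff_C_mul, Polynomial.coeff_X_pow, if_neg, mul_zero]
      exact fun h => hne (hinj m hm m₁ hm₁ h.symm)
    · intro h; exact (h hm₁).elim
  have hca : Qμ.coeff (ex ma) ≠ 0 := by
    rw [hcoeff ma hmaT]; exact MvPolynomial.mem_support_iff.1 hma
  have hcc : Qμ.coeff (ex mc) ≠ 0 := by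
    rw [hcoeff mc hmcT]; exact MvPolynomial.mem_support_iff.1 hmc
  obtain ⟨θ, hθ0, hθ⟩ : ∃ θ : ℂ, θ ≠ 0 ∧ Qμ.eval θ = 0 := by
    rcases lt_or_gt_of_ne hjne with hlt | hgt
    · exact exists_root_ne_zero_of_coeff_ne_zero (ex mc) Qμ (ex ma) hlt hca hcc
    · exact exists_root_ne_zero_of_coeff_ne_zero (ex ma) Qμ (ex mc) hgt hcc hca
  have hQ : Qμ ≠ 0 := fun h => hca (by rw [h, Polynomial.coeff_zero])
  -- located zeros with the value datum
  obtain ⟨t, ns, hns, ht, hpos, B, hval⟩ := exists_zeros_log_dir_val g₀ hd Q.support q ex μ κ hκ'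
    hθ0 hθ hQ ω σ hσ hω
  refine ⟨t, fun k => ?_, ?_⟩
  · rw [eval₃_eq_sum_coeffPoly_of_y0 Q hQ2]
    have h := ht k
    simpa only [hq_def, hex_def, ← Complex.exp_nat_mul, Polynomial.eval_mul, Polynomial.eval_C,
      Polynomial.eval_pow, Polynomial.eval_X] using h
  · -- `‖t_k‖ → ∞` from the position, then the tilted growth lemma
    have hg0 : g₀ ≠ 0 := by rintro rfl; rw [Polynomial.natDegree_zero] at hd; omega
    have hω0 : ω ≠ 0 := by
      intro h0
      rw [h0, zero_pow (by omega), mul_zero] at hω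
      have hs0 : (σ : ℂ) ≠ 0 := by rcases hσ with rfl | rfl <;> simp
      have hπ : (Real.pi : ℂ) ≠ 0 := Complex.ofReal_ne_zero.mpr Real.pi_pos.ne'
      exact absurd hω.symm (by simp [hs0, hπ, Complex.I_ne_zero])
    have hωpos : 0 < ‖ω‖ := norm_pos_iff.2 hω0
    set τ : ℂ := -(g₀.coeff (g₀.natDegree - 1) / (g₀.natDegree * g₀.leadingCoeff)) with hτ
    have hbd : ∀ᶠ k in atTop, ‖t k - ((ns k : ℂ) + 1) * ω‖ ≤ ‖τ‖ + 1 := by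
      have h := hpos (Metric.closedBall_mem_nhds τ one_pos)
      filter_upwards [h] with k hk
      rw [Set.mem_preimage, Metric.mem_closedBall, dist_eq_norm] at hk
      have := norm_le_insert' (t k - ((ns k : ℂ) + 1) * ω) τ
      linarith
    have hnorm : Tendsto (fun k => ‖t k‖) atTop atTop := by
      have h1 : Tendsto (fun k => (((ns k : ℝ)) + 1) * ‖ω‖ - (‖τ‖ + 1)) atTop atTop :=
        tendsto_atTop_add_const_right _ _
          ((tendsto_atTop_add_const_right _ _
            (tendsto_natCast_atTop_atTop.comp hns)).atTop_mul_const hωpos)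
      refine tendsto_atTop_mono' atTop ?_ h1
      filter_upwards [hbd] with k hk
      have e1 : ‖((ns k : ℂ) + 1) * ω‖ = ((ns k : ℝ) + 1) * ‖ω‖ := by
        rw [norm_mul]; congr 1
        rw [show ((ns k : ℂ) + 1) = (((ns k : ℝ) + 1 : ℝ) : ℂ) by push_cast; ring,
          Complex.norm_real, Real.norm_eq_abs, abs_of_nonneg (by positivity)]
      have := norm_sub_norm_le (((ns k : ℂ) + 1) * ω) (t k)
      rw [norm_sub_rev] at hk
      linarith
    rw [hD]
    exact tendsto_growth_eval_of_tilt g₀ hd c hc e he hph D hDdeg hnorm hμ hval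

/-! ## Part B. The density theorems along a tilted edge -/

section Main

variable (g₀ g₁ : Polynomial ℂ) {Q : MvPolynomial (Fin 3) ℂ}

/-- **Density below the gap along a tilted edge (any decomposition).**  `d = deg g₀ ≥ 2`,
`g₁ = c g₀^e + D`, `e ≥ 2`, `c ≠ 0`, `Re(c i^e) = 0`, `deg D ≤ d(e-1)`; `Q ∈ ℂ[t, y₀]` irreducible
with an upper edge of NONZERO slope through two monomials of different `y₀`-degree ⟹ the
exponential points of `S(g; Q)` are Zariski dense. [cite: MantovaMasser2023, §1 Further remarks,
p. 5 (the question, open in general)] (new) -/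
theorem unprojectedDense_paramSurface₃_of_y0_tilt_edge (hd : 2 ≤ g₀.natDegree)
    (hirr : Irreducible Q) (hQ2 : ∀ m ∈ Q.support, m 2 = 0) (μ κ : ℝ) (hμ : μ ≠ 0)
    (hκ : ∀ m ∈ Q.support, ((m 0 : ℕ) : ℝ) + μ * (m 1 : ℕ) ≤ κ)
    {ma mc : Fin 3 →₀ ℕ} (hma : ma ∈ Q.support) (hmc : mc ∈ Q.support) (hjne : ma 1 ≠ mc 1)
    (hja : ((ma 0 : ℕ) : ℝ) + μ * (ma 1 : ℕ) = κ) (hjc : ((mc 0 : ℕ) : ℝ) + μ * (mc 1 : ℕ) = κ)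
    {c : ℂ} (hc : c ≠ 0) {e : ℕ} (he : 2 ≤ e) {D : Polynomial ℂ}
    (hD : g₁ = Polynomial.C c * g₀ ^ e + D) (hph : (c * I ^ e).re = 0)
    (hDdeg : D.natDegree ≤ g₀.natDegree * (e - 1)) :
    UnprojectedDense {w : Fin 2 ⊕ Fin 2 → ℂ | ∃ t : ℂ, w (Sum.inl 0) = g₀.eval t ∧
      w (Sum.inl 1) = g₁.eval t ∧
      MvPolynomial.eval (Fin.cases t (fun i => w (Sum.inr i)) : Fin 3 → ℂ) Q = 0} := by
  have hg₀ : 1 ≤ g₀.natDegree := by omega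
  have hg0 : g₀ ≠ 0 := by rintro rfl; rw [Polynomial.natDegree_zero] at hd; omega
  have ha0 : g₀.leadingCoeff ≠ 0 := Polynomial.leadingCoeff_ne_zero.2 hg0
  obtain ⟨ω, σ, hσ, hω, -⟩ := exists_rootDirection g₀.leadingCoeff ha0 g₀.natDegree hd
  obtain ⟨t, ht, hgr⟩ := exists_paramSurface_expPoints_of_y0_tilt g₀ g₁ hd Q hQ2 μ κ hμ hκ hma
    hmc hjne hja hjc hc he hD hph hDdeg hσ hω
  exact unprojectedDense_paramSurface₃_of_expPoints₁ g₀ g₁ Q ht hgr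
    (isIrreducibleClosed_paramSurface₃ g₀ g₁ hg₀ hirr)
    (by rw [zariskiDim_paramSurface₃ g₀ g₁ hg₀ hirr])

/-- **FIBRE CURVES WHOSE TOP ROW MISSES THE RIGHTMOST COLUMN ARE DENSE IN ALL REGIMES.**
`2 ≤ d = deg g₀ < n = deg g₁`; `Q ∈ ℂ[t, y₀]` irreducible with a monomial `m₀` of maximal
`t`-degree that is rightmost in the top `t`-row, and SOME monomial of larger `y₀`-degree ⟹ the
exponential points of `S(g; Q)` are Zariski dense (`d ∤ n` or non-vanishing phase: file XXI; gap:
file XL; no gap: the tilted edge). [cite: MantovaMasser2023, §1 Further remarks, p. 5 (the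
question, open in general)] (new) -/
theorem unprojectedDense_paramSurface₃_of_y0_topRight (hd : 2 ≤ g₀.natDegree)
    (hlt : g₀.natDegree < g₁.natDegree) (hirr : Irreducible Q) (hQ2 : ∀ m ∈ Q.support, m 2 = 0)
    {m₀ : Fin 3 →₀ ℕ} (hm₀ : m₀ ∈ Q.support) (htop : ∀ m ∈ Q.support, m 0 ≤ m₀ 0)
    (hrow : ∀ m ∈ Q.support, m 0 = m₀ 0 → m 1 ≤ m₀ 1) (hright : ∃ m ∈ Q.support, m₀ 1 < m 1) :
    UnprojectedDense {w : Fin 2 ⊕ Fin 2 → ℂ | ∃ t : ℂ, w (Sum.inl 0) = g₀.eval t ∧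
      w (Sum.inl 1) = g₁.eval t ∧
      MvPolynomial.eval (Fin.cases t (fun i => w (Sum.inr i)) : Fin 3 → ℂ) Q = 0} := by
  have hn : 1 ≤ g₁.natDegree := by omega
  have h1 : ∃ m ∈ Q.support, ∃ m' ∈ Q.support, m 1 ≠ m' 1 := by
    obtain ⟨m, hm, hlt'⟩ := hright
    exact ⟨m₀, hm₀, m, hm, hlt'.ne⟩
  by_cases hph : ¬ g₀.natDegree ∣ g₁.natDegree ∨
      (g₁.leadingCoeff * (I / g₀.leadingCoeff) ^ (g₁.natDegree / g₀.natDegree)).re ≠ 0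
  · exact unprojectedDense_paramSurface₃_of_y0 g₀ g₁ hd hn hph hirr hQ2 h1
  push Not at hph
  obtain ⟨hdvd, hph0⟩ := hph
  by_cases hgap : g₁.natDegree <
      (Polynomial.C (g₀.leadingCoeff ^ (g₁.natDegree / g₀.natDegree)) * g₁ -
        Polynomial.C g₁.leadingCoeff * g₀ ^ (g₁.natDegree / g₀.natDegree)).natDegree + g₀.natDegree
  · exact unprojectedDense_paramSurface₃_of_y0_gap_canonical g₀ g₁ hd hn hdvd hph0 hgap hirr hQ2 h1
  push Not at hgap
  -- no gap: the canonical decomposition and the tilted edge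
  have hg0 : g₀ ≠ 0 := by rintro rfl; rw [Polynomial.natDegree_zero] at hd; omega
  have hg1 : g₁ ≠ 0 := by rintro rfl; rw [Polynomial.natDegree_zero] at hn; omega
  have ha0 : g₀.leadingCoeff ≠ 0 := Polynomial.leadingCoeff_ne_zero.2 hg0
  set e := g₁.natDegree / g₀.natDegree with he_def
  set a := g₀.leadingCoeff with ha
  have hae : a ^ e ≠ 0 := pow_ne_zero _ ha0
  have hne : g₀.natDegree * e = g₁.natDegree := Nat.mul_div_cancel' hdvd
  have he2 : 2 ≤ e := by
    by_contra hlt2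
    have : e ≤ 1 := by omega
    have := Nat.mul_le_mul_left g₀.natDegree this
    rw [hne, mul_one] at this
    omega
  set c : ℂ := g₁.leadingCoeff / a ^ e with hc_def
  have hc0 : c ≠ 0 := div_ne_zero (Polynomial.leadingCoeff_ne_zero.2 hg1) hae
  set P := Polynomial.C (a ^ e) * g₁ - Polynomial.C g₁.leadingCoeff * g₀ ^ e with hP
  set D := Polynomial.C ((a ^ e)⁻¹) * P with hDdef
  have hD : g₁ = Polynomial.C c * g₀ ^ e + D := by
    rw [hDdef, hP, hc_def, div_eq_mul_inv, mul_sub, ← mul_assoc, ← mul_assoc, ← Polynomial.C_mul,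
      ← Polynomial.C_mul, inv_mul_cancel₀ hae, Polynomial.C_1, one_mul, mul_comm _⁻¹]
    ring
  have hDdeg : D.natDegree ≤ g₀.natDegree * (e - 1) := by
    rw [hDdef, Polynomial.natDegree_C_mul (inv_ne_zero hae)]
    have hmul : g₀.natDegree * (e - 1) + g₀.natDegree = g₀.natDegree * e := by
      rw [Nat.mul_sub_one, Nat.sub_add_cancel]
      exact Nat.le_mul_of_pos_right _ (by omega)
    have hgapP : P.natDegree + g₀.natDegree ≤ g₁.natDegree := hgap
    omega
  have hph' : (c * I ^ e).re = 0 := by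
    rw [hc_def, show g₁.leadingCoeff / a ^ e * I ^ e = g₁.leadingCoeff * (I / a) ^ e by
      rw [div_pow]; ring]
    exact hph0
  obtain ⟨μ, κ, hμ, hκ, ma, hma, mc, hmc, hjne, hja, hjc⟩ :=
    exists_upper_edge_tilt_right Q.support (fun m => m 1) (fun m => m 0) hm₀ htop hrow hright
  exact unprojectedDense_paramSurface₃_of_y0_tilt_edge g₀ g₁ hd hirr hQ2 μ κ hμ hκ hma hmc hjne hja
    hjc hc0 he2 hD hph' hDdeg

/-- **FIBRE CURVES WHOSE TOP ROW MISSES THE LEFTMOST COLUMN ARE DENSE IN ALL REGIMES** (mirror: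
`m₀` leftmost in the top row and some monomial of smaller `y₀`-degree). [cite: MantovaMasser2023,
§1 Further remarks, p. 5 (the question, open in general)] (new) -/
theorem unprojectedDense_paramSurface₃_of_y0_topLeft (hd : 2 ≤ g₀.natDegree)
    (hlt : g₀.natDegree < g₁.natDegree) (hirr : Irreducible Q) (hQ2 : ∀ m ∈ Q.support, m 2 = 0)
    {m₀ : Fin 3 →₀ ℕ} (hm₀ : m₀ ∈ Q.support) (htop : ∀ m ∈ Q.support, m 0 ≤ m₀ 0)
    (hrow : ∀ m ∈ Q.support, m 0 = m₀ 0 → m₀ 1 ≤ m 1) (hleft : ∃ m ∈ Q.support, m 1 < m₀ 1) :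
    UnprojectedDense {w : Fin 2 ⊕ Fin 2 → ℂ | ∃ t : ℂ, w (Sum.inl 0) = g₀.eval t ∧
      w (Sum.inl 1) = g₁.eval t ∧
      MvPolynomial.eval (Fin.cases t (fun i => w (Sum.inr i)) : Fin 3 → ℂ) Q = 0} := by
  have hn : 1 ≤ g₁.natDegree := by omega
  have h1 : ∃ m ∈ Q.support, ∃ m' ∈ Q.support, m 1 ≠ m' 1 := by
    obtain ⟨m, hm, hlt'⟩ := hleft
    exact ⟨m, hm, m₀, hm₀, hlt'.ne⟩
  by_cases hph : ¬ g₀.natDegree ∣ g₁.natDegree ∨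
      (g₁.leadingCoeff * (I / g₀.leadingCoeff) ^ (g₁.natDegree / g₀.natDegree)).re ≠ 0
  · exact unprojectedDense_paramSurface₃_of_y0 g₀ g₁ hd hn hph hirr hQ2 h1
  push Not at hph
  obtain ⟨hdvd, hph0⟩ := hph
  by_cases hgap : g₁.natDegree <
      (Polynomial.C (g₀.leadingCoeff ^ (g₁.natDegree / g₀.natDegree)) * g₁ -
        Polynomial.C g₁.leadingCoeff * g₀ ^ (g₁.natDegree / g₀.natDegree)).natDegree + g₀.natDegree
  · exact unprojectedDense_paramSurface₃_of_y0_gap_canonical g₀ g₁ hd hn hdvd hph0 hgap hirr hQ2 h1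
  push Not at hgap
  have hg0 : g₀ ≠ 0 := by rintro rfl; rw [Polynomial.natDegree_zero] at hd; omega
  have hg1 : g₁ ≠ 0 := by rintro rfl; rw [Polynomial.natDegree_zero] at hn; omega
  have ha0 : g₀.leadingCoeff ≠ 0 := Polynomial.leadingCoeff_ne_zero.2 hg0
  set e := g₁.natDegree / g₀.natDegree with he_def
  set a := g₀.leadingCoeff with ha
  have hae : a ^ e ≠ 0 := pow_ne_zero _ ha0
  have hne : g₀.natDegree * e = g₁.natDegree := Nat.mul_div_cancel' hdvd
  have he2 : 2 ≤ e := by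
    by_contra hlt2
    have : e ≤ 1 := by omega
    have := Nat.mul_le_mul_left g₀.natDegree this
    rw [hne, mul_one] at this
    omega
  set c : ℂ := g₁.leadingCoeff / a ^ e with hc_def
  have hc0 : c ≠ 0 := div_ne_zero (Polynomial.leadingCoeff_ne_zero.2 hg1) hae
  set P := Polynomial.C (a ^ e) * g₁ - Polynomial.C g₁.leadingCoeff * g₀ ^ e with hP
  set D := Polynomial.C ((a ^ e)⁻¹) * P with hDdef
  have hD : g₁ = Polynomial.C c * g₀ ^ e + D := by
    rw [hDdef, hP, hc_def, div_eq_mul_inv, mul_sub, ← mul_assoc, ← mul_assoc, ← Polynomial.C_mul,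
      ← Polynomial.C_mul, inv_mul_cancel₀ hae, Polynomial.C_1, one_mul, mul_comm _⁻¹]
    ring
  have hDdeg : D.natDegree ≤ g₀.natDegree * (e - 1) := by
    rw [hDdef, Polynomial.natDegree_C_mul (inv_ne_zero hae)]
    have hmul : g₀.natDegree * (e - 1) + g₀.natDegree = g₀.natDegree * e := by
      rw [Nat.mul_sub_one, Nat.sub_add_cancel]
      exact Nat.le_mul_of_pos_right _ (by omega)
    have hgapP : P.natDegree + g₀.natDegree ≤ g₁.natDegree := hgap
    omega
  have hph' : (c * I ^ e).re = 0 := by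
    rw [hc_def, show g₁.leadingCoeff / a ^ e * I ^ e = g₁.leadingCoeff * (I / a) ^ e by
      rw [div_pow]; ring]
    exact hph0
  obtain ⟨μ, κ, hμ, hκ, ma, hma, mc, hmc, hjne, hja, hjc⟩ :=
    exists_upper_edge_tilt_left Q.support (fun m => m 1) (fun m => m 0) hm₀ htop hrow hleft
  exact unprojectedDense_paramSurface₃_of_y0_tilt_edge g₀ g₁ hd hirr hQ2 μ κ hμ hκ hma hmc hjne hja
    hjc hc0 he2 hD hph' hDdeg

end Main

end Summit.Schanuel.Schanuel.Theorems
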